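import Literature.MathematicalPhysics.QuantumFieldTheory.Balaban1983to89.B7Eq136SecondOrder

/-!
# `Balaban1983to89.B9Ineq3137From149` — T. Bałaban, *Propagators for lattice gauge theories in a background field*, Commun. Math. Phys.
**99** (1985) 389–434 [Balaban1985BackgroundPropagators], pp. 422–423: **«The inequality (149) in [5] implies |⟨δA, Δ⁽²⁾A⟩| ≦ O(1)C₃Mα₀
Σ_{j}Σ_{b∈Λ_j}(Lʲη)^{d−2}(Q″_j|δA|)(c)|A|_c»** — the step from (3.136), the `(H*J)`-bound and (149) FOR THE SECOND-ORDER TERM `C_j⁽²⁾` (file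
`B7Eq136SecondOrder`) to the displayed bound, PROVED: the bookkeeping over the multiscale set `𝔅 = ⋃Λ_j` abstractly, and the level-`j` piece
with the CONCRETE `C_j⁽²⁾(U₀, ·)` of [5] on the `ℤᵈ` carrier; plus the hence-step to the per-bond shape (3.137) through the count dual to
[5] (141)/(142)

statement-level skeleton of published theorems with citation tags; proofs where landed; nothing here is a claim about the Yang–Mills mass gap

v1.1 (p06 gen 8, 2026-08-21): DOCFIX ONLY — citation page numerals: (3.137) is printed at the top of p. 423 [PDF 35] ((3.134)–(3.136) on p. 422);
`[cite]` locators re-pointed (CITELOC row P31-180); declarations byte-identical.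

PDF held: `paper:balaban1985-cmp99-background-propagators` (journal page = PDF page + 388); pp. 421–423 read from the page renders
`…/1985-cmp99-background-propagators-p033-x2.png`, `-p034-x2.png`, `-p035-x2.png` (read as images); [5] = `paper:balaban1985-cmp98-averaging`
pp. 39–40 (renders `-p023-x2.png`, `-p024-x2.png`).

CITATION HEADER / WHAT IS REPRODUCED.  Cell `lit-balaban`, Phase-2 proof seat p06 gen 5 = unit `lit-balaban-p06` (TAKING line HOME/STATUS.md
2026-08-21T07:19:10Z; file 3 of the `C_j⁽²⁾` lane); SKELETON row **B9.Eq3.134** ((3.134)–(3.137); owner r06; typed+proved by p10's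
`B9Delta2Def134`, whose hence-steps take the printed-shape HYPOTHESES `h149` (the display below) and `h3133`/`h336`).  THE PRINT, p. 422
[PDF 34]: *«To find bounds for the operator Δ⁽²⁾ let us write it in the form Δ⁽²⁾A = Σ_{j=1}^{k} Σ_{b∈Λ_j} (Lʲη)^{d+1} tr (δ/δA) C_j⁽²⁾(A,b)(H\*J)(b).
(3.136) From the regularity condition (3.36) and the inequality (3.133) we have the estimate |(H\*J)(b)| ≦ O(1)Mα₀(Lʲη)⁻³ for b ∈ Λ_j. The
inequality (149) in [5] implies |⟨δA, Δ⁽²⁾A⟩| ≦ O(1)C₃Mα₀ Σ_{j=0}^{k} Σ_{b∈Λ_j} (Lʲη)^{d−2}(Q″_j|δA|)(c)|A|_c,»* p. 423 [PDF 35]: *«hence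
|(Δ⁽²⁾A)(b)| ≦ O(1)Mα₀(Lʲη)⁻²|A|, b ∈ Δ(y), y ∈ Λ_j, (3.137) and the supremum |A| is taken over several j-blocks surrounding Δ(y).»*  [5] p. 40:
*«|⟨(δ/δA)C_j(U₀, A), δA⟩| ≦ C₃|A|Q″_j|δA|, (149)»*; p. 39: *«(Q″_kA)_c = Σ_{b⊂Bᵏ(c₋)∪Bᵏ(c₊)} η^dA_b (141)»*, *«|Q″Q″_jA| ≦ … ≦ 2dQ″_{j+1}|A| (142)»*.

READING (the two printed steps, as bookkeeping).  (i) By (3.134) and (3.136), `⟨δA, Δ⁽²⁾A⟩ = Σ_jΣ_{b∈Λ_j}(Lʲη)^{d+1} tr[⟨(δ/δA)C_j⁽²⁾(A,b),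
δA⟩·(H*J)(b)]`; each term is bounded by `(Lʲη)^{d+1}·|⟨(δ/δA)C_j⁽²⁾(A,b), δA⟩|·|(H*J)(b)|`; (149) FOR `C_j⁽²⁾` (`B7Eq136SecondOrder.ineq149_secondOrder`
— a second-order homogeneous term inherits (149) with the same constant) bounds the first factor by `C₃|A|_b(Q″_j|δA|)(b)`, the `(H*J)`-estimate the
second by `O(1)Mα₀(Lʲη)⁻³`, and `(Lʲη)^{d+1}(Lʲη)⁻³ = (Lʲη)^{d−2}` — the display.  (ii) Testing the display against a variation supported on ONE
fine bond `x ∈ Δ(y)`, `y ∈ Λ_j`: `(Q″_j|δA|)(b) = (Lʲη)^{−d}η^d|δA_x|` for the at most `2d` bonds `b ∈ Λ_j` with `x ⊂ Bʲ(b₋) ∪ Bʲ(b₊)` and `0`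
otherwise (the count dual to (141)/(142)), so the pairing `η^d tr[δA_x(Δ⁽²⁾A)(x)]` is at most `2d·O(1)C₃Mα₀(Lʲη)^{d−2}(Lʲη)^{−d}|A|·η^d|δA_x|` —
(3.137) with `O(1) ↦ 2d·O(1)C₃`.

DICTIONARY (tree units of [5]'s concrete files: level `j` rescaled to `ℤᵈ`, fine spacing `1`, coarse spacing `Lʲ`; so `Lʲη ↦ Lʲ`, `η^d ↦ 1`,
`(Q″_j f)(c) ↦ Σ_s kerQdd L j z κ s·f_s` with `kerQdd = L^{−jd}𝟙[s ⊂ Bʲ(c₋) ∪ Bʲ(c₊)]` (`B7Prop5GeneralOperators.kerQdd`), `|A|·` ↦ `(Lʲ)²‖a‖`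
as in `B7Ineq149Pairing`/`B7Eq136SecondOrder`).  At ONE level `j` with the CONCRETE `C_j⁽²⁾(U₀, ins_S a)(c) = CCovIter2 L U₀ (insCfg S a) j z κ`
(file 1), a finite set `T` of coarse bonds `c = (z, κ)` («b ∈ Λ_j»), an `𝔸`-valued bond function `K` («(H\*J)(b)»), and weights `w_c ≥ 0`
(«(Lʲη)^{d+1}»), the level-`j` part of `⟨C⁽²⁾(A), H*J⟩` BEFORE the trace is `F(a) = Σ_{c∈T} w_c·C_j⁽²⁾(U₀, ins_S a)(c)·K(c) ∈ 𝔸` and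
`⟨δA, Δ⁽²⁾A⟩`'s level-`j` part is `tr DF(a)δa`; every continuous trace functional `τ` only costs a factor `‖τ‖`, so the file bounds
`‖DF(a)δa‖`.

WHAT THIS FILE PROVES (theorems only; kernel, 0 sorry, standard axioms).
* §1 (abstract, over any finite index set of coarse bonds `i` with scale `ℓ_i > 0`): **`display_of_136_149_137a`** — from the termwise form of
  (3.136) (`|form| ≤ Σ_i ℓ_i^{d+1}·T_i·K_i`), (149) for `C⁽²⁾` termwise (`T_i ≤ C₃·Asup_i·qdd_i`) and the `(H*J)`-bound (`K_i ≤ cMα₀ℓ_i⁻³`):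
  `|form| ≤ cC₃Mα₀·Σ_i ℓ_i^{d+1}ℓ_i⁻³·qdd_i·Asup_i`, and `ℓ^{d+1}ℓ⁻³ = ℓ^{d−2}` for `d ≥ 2` (`pow_scale`).
* §2 **`sum_kerQdd_transpose_le`** — THE COUNT DUAL TO (141)/(142): a fine bond `s` lies in the box `Bʲ(c₋) ∪ Bʲ(c₊)` of at most `2d` coarse
  bonds `c`, so `Σ_{c∈T} kerQdd(c, s) ≤ 2d·L^{−jd}` for every finite `T`.
* §3 (concrete, level `j ≤ k`, regime of `B7Eq136SecondOrder`): **`hasFDerivAt_secondForm`** = (3.136) at level `j`: `F` is differentiable and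
  `DF(a)δa = Σ_c w_c·(D[C_j⁽²⁾(U₀, ins_S ·)(c)](a)δa)·K(c)`; **`norm_fderiv_secondForm_le`** = THE DISPLAY at level `j`:
  `‖DF(a)δa‖ ≤ C₃(Lʲ)²‖a‖·Σ_c w_c‖K(c)‖·Σ_s kerQdd(c,s)‖δa_s‖`; **`norm_fderiv_secondForm_single_le`** = THE HENCE-STEP at level `j`: with
  `w_c‖K(c)‖ ≤ κ₀`, for a variation `X·e_s` on one fine bond, `‖DF(a)(X·e_s)‖ ≤ 2d·κ₀·C₃(Lʲ)²·L^{−jd}·‖a‖·‖X‖` — (3.137)'s shape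
  `O(1)Mα₀(Lʲη)⁻²|A|` in tree units, `O(1) ↦ 2dC₃·O(1)`.
NOT CLAIMED: the objects `H`, `J`, `Λ_j` of [B9] Sect. D (hypothesis shapes `K`, `T`, `w` here, exactly as in `B9Delta2Def134`); the `(H*J)`-bound
itself (`B9Ineq3137Regular`); the identification of p10's real-coordinate matrix `𝒞` with `F` (a choice of basis of `𝔤`); smallness conclusions.
-/

noncomputable section

open scoped BigOperators Topology
open NormedSpace Finset Metric Filter

namespace Literature.MathematicalPhysics.QuantumFieldTheory.Balaban1983to89.B9Ineq3137From149

open B7Prop1Explicit B7Prop1Local B7Prop2Explicit B7Prop3Flat B7Prop4Flat B7Eq92Concrete B7Prop3GeneralLinear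
  B7Prop4GeneralLevels B7Prop5GeneralOperators B7Prop5GeneralInduction B7Prop5GeneralLevels B7Ineq149Pairing B7Eq136SecondOrder
open B7Prop5Flat (BondIn)

-- `Site` alone would resolve to the torus sites of `Setup.lean`; re-export the `ℤ^d` sites of `B7Prop1Explicit`.
export B7Prop1Explicit (Site)

variable {d : ℕ}

/-! ## §1 The printed «implies»: bookkeeping over `𝔅 = ⋃_j Λ_j` -/

section Abstract

variable {ι : Type*}

/-- `ℓ^{d+1}·ℓ⁻³ = ℓ^{d−2}` for `d ≥ 2`, `ℓ ≠ 0` (the exponent of the display). [cite: Balaban1985BackgroundPropagators, (3.136) p.422, (3.137) p.423] -/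
theorem pow_scale {ℓ : ℝ} (hℓ : ℓ ≠ 0) {d : ℕ} (hd : 2 ≤ d) : ℓ ^ (d + 1) * ℓ⁻¹ ^ 3 = ℓ ^ (d - 2) := by
  obtain ⟨m, rfl⟩ := Nat.exists_eq_add_of_le hd
  rw [show 2 + m - 2 = m from by omega, show 2 + m + 1 = m + 3 from by omega, pow_add, inv_pow, mul_assoc,
    mul_inv_cancel₀ (pow_ne_zero 3 hℓ), mul_one]

/-- **«The inequality (149) in [5] implies |⟨δA, Δ⁽²⁾A⟩| ≦ O(1)C₃Mα₀ ΣΣ (Lʲη)^{d−2}(Q″_j|δA|)(c)|A|_c»** — the bookkeeping, over a finite set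
`I` of coarse bonds `i` («b ∈ Λ_j», scale `ℓ_i = Lʲη`): from (3.136) termwise (`|⟨δA,Δ⁽²⁾A⟩| ≤ Σ_i ℓ_i^{d+1}·T_i·K_i` with
`T_i = |⟨(δ/δA)C_j⁽²⁾(A, b_i), δA⟩|`, `K_i = |(H*J)(b_i)|`, `|tr XY| ≤ |X||Y|`), (149) FOR `C⁽²⁾` (`T_i ≤ C₃·Asup_i·qdd_i`, `Asup_i = |A|_{b_i}`,
`qdd_i = (Q″_j|δA|)(b_i)`; `B7Eq136SecondOrder.ineq149_secondOrder`) and `K_i ≤ cMα₀ℓ_i⁻³`: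
`|⟨δA,Δ⁽²⁾A⟩| ≤ cC₃Mα₀·Σ_i ℓ_i^{d+1}ℓ_i⁻³·qdd_i·Asup_i`. [cite: Balaban1985BackgroundPropagators, (3.136) p.422, (3.137) p.423]
[cite: Balaban1985Averaging, (149) p.40] -/
theorem display_of_136_149_137a (I : Finset ι) (d : ℕ) (form : ℝ) (ℓ T K qdd Asup : ι → ℝ) (c C₃ M α₀ : ℝ)
    (hC₃ : 0 ≤ C₃) (hℓ : ∀ i ∈ I, 0 < ℓ i) (hK : ∀ i ∈ I, 0 ≤ K i)
    (hqdd : ∀ i ∈ I, 0 ≤ qdd i) (hAsup : ∀ i ∈ I, 0 ≤ Asup i)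
    (h136 : |form| ≤ ∑ i ∈ I, ℓ i ^ (d + 1) * T i * K i)
    (h149 : ∀ i ∈ I, T i ≤ C₃ * Asup i * qdd i)
    (h137a : ∀ i ∈ I, K i ≤ c * M * α₀ * (ℓ i)⁻¹ ^ 3) :
    |form| ≤ c * C₃ * M * α₀ * ∑ i ∈ I, ℓ i ^ (d + 1) * (ℓ i)⁻¹ ^ 3 * qdd i * Asup i := by
  refine h136.trans ?_
  rw [mul_sum]
  refine sum_le_sum fun i hi => ?_
  have hℓi : 0 ≤ ℓ i ^ (d + 1) := pow_nonneg (hℓ i hi).le _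
  calc ℓ i ^ (d + 1) * T i * K i ≤ ℓ i ^ (d + 1) * (C₃ * Asup i * qdd i) * (c * M * α₀ * (ℓ i)⁻¹ ^ 3) :=
        mul_le_mul (mul_le_mul_of_nonneg_left (h149 i hi) hℓi) (h137a i hi) (hK i hi)
          (mul_nonneg hℓi (mul_nonneg (mul_nonneg hC₃ (hAsup i hi)) (hqdd i hi)))
    _ = c * C₃ * M * α₀ * (ℓ i ^ (d + 1) * (ℓ i)⁻¹ ^ 3 * qdd i * Asup i) := by ring

/-- The display with the printed exponent `(Lʲη)^{d−2}` (`d ≥ 2`). [cite: Balaban1985BackgroundPropagators, (3.136) p.422, (3.137) p.423] -/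
theorem display_of_136_149_137a' (I : Finset ι) {d : ℕ} (hd : 2 ≤ d) (form : ℝ) (ℓ T K qdd Asup : ι → ℝ) (c C₃ M α₀ : ℝ)
    (hC₃ : 0 ≤ C₃) (hℓ : ∀ i ∈ I, 0 < ℓ i) (hK : ∀ i ∈ I, 0 ≤ K i)
    (hqdd : ∀ i ∈ I, 0 ≤ qdd i) (hAsup : ∀ i ∈ I, 0 ≤ Asup i)
    (h136 : |form| ≤ ∑ i ∈ I, ℓ i ^ (d + 1) * T i * K i)
    (h149 : ∀ i ∈ I, T i ≤ C₃ * Asup i * qdd i)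
    (h137a : ∀ i ∈ I, K i ≤ c * M * α₀ * (ℓ i)⁻¹ ^ 3) :
    |form| ≤ c * C₃ * M * α₀ * ∑ i ∈ I, ℓ i ^ (d - 2) * qdd i * Asup i := by
  have h := display_of_136_149_137a I d form ℓ T K qdd Asup c C₃ M α₀ hC₃ hℓ hK hqdd hAsup h136 h149 h137a
  refine h.trans (le_of_eq ?_)
  congr 1
  refine sum_congr rfl fun i hi => ?_
  rw [pow_scale (hℓ i hi).ne' hd]

end Abstract

/-! ## §2 The count dual to [5] (141)/(142): a fine bond lies in at most `2d` boxes `Bʲ(c₋) ∪ Bʲ(c₊)` -/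

section Count

/-- the coarse bonds `c = (z, κ)` whose box `Bʲ(c₋) ∪ Bʲ(c₊)` contains the fine bond `(y, μ)` have `z` determined by `κ` up to one binary
choice (the κ-th block coordinate of `y` or its predecessor). [cite: Balaban1985Averaging, (141)–(142) p.39] -/
theorem bondIn_box_cases {L : ℕ} (hL : 1 ≤ L) (j : ℕ) {z : Site d} {κ : Fin d} {y : Site d} {μ : Fin d}
    (h : BondIn (loK L j z) (bondHiK L j z κ) y μ) :
    ∃ t : Bool, z = fun i => if i = κ ∧ t = true then y i / ((L : ℤ) ^ j) - 1 else y i / ((L : ℤ) ^ j) := by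
  have hP : (0 : ℤ) < (L : ℤ) ^ j := by positivity
  have hy := h.1
  -- coordinates `i ≠ κ`: `Lʲ z_i ≤ y_i ≤ Lʲ z_i + Lʲ − 1` forces `z_i = ⌊y_i / Lʲ⌋`
  have hne : ∀ i, i ≠ κ → z i = y i / ((L : ℤ) ^ j) := by
    intro i hi
    have h1 := (hy i).1
    have h2 := (hy i).2
    simp only [loK] at h1
    simp only [bondHiK, if_neg hi, add_zero] at h2
    have hle : z i ≤ y i / ((L : ℤ) ^ j) := Int.le_ediv_of_mul_le hP (by linarith)
    have hlt : y i / ((L : ℤ) ^ j) < z i + 1 := Int.ediv_lt_of_lt_mul hP (by linarith)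
    omega
  -- coordinate `κ`: `Lʲ z_κ ≤ y_κ ≤ Lʲ z_κ + 2Lʲ − 1`, two possibilities
  have h1 := (hy κ).1
  have h2 := (hy κ).2
  simp only [loK] at h1
  simp only [bondHiK, ite_true] at h2
  have hle : z κ ≤ y κ / ((L : ℤ) ^ j) := Int.le_ediv_of_mul_le hP (by linarith)
  have hlt : y κ / ((L : ℤ) ^ j) < z κ + 2 := Int.ediv_lt_of_lt_mul hP (by linarith)
  by_cases hq : z κ = y κ / ((L : ℤ) ^ j)
  · refine ⟨false, funext fun i => ?_⟩
    by_cases hi : i = κ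
    · subst hi; simp [hq]
    · simp [hi, hne i hi]
  · refine ⟨true, funext fun i => ?_⟩
    by_cases hi : i = κ
    · subst hi; simp; omega
    · simp [hi, hne i hi]

/-- **THE COUNT DUAL TO (141)/(142)**: for a fixed fine bond `s = (y, μ)`, at most `2d` coarse bonds `c = (z, κ)` have `s ⊂ Bʲ(c₋) ∪ Bʲ(c₊)`;
hence `Σ_{c∈T} kerQdd L j c s ≤ 2d·L^{−jd}` for every finite set `T` of coarse bonds («the supremum |A| is taken over several j-blocks
surrounding Δ(y)» — dually, one fine bond is seen by several coarse bonds). [cite: Balaban1985Averaging, (141)–(142) p.39]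
[cite: Balaban1985BackgroundPropagators, (3.137) p.423] -/
theorem sum_kerQdd_transpose_le {L : ℕ} (hL : 1 ≤ L) (j : ℕ) (T : Finset (Site d × Fin d)) (y : Site d) (μ : Fin d) :
    ∑ c ∈ T, kerQdd L j c.1 c.2 y μ ≤ 2 * d * (((L : ℝ) ^ j) ^ d)⁻¹ := by
  classical
  set f : Fin d × Bool → Site d × Fin d := fun p =>
    ((fun i => if i = p.1 ∧ p.2 = true then y i / ((L : ℤ) ^ j) - 1 else y i / ((L : ℤ) ^ j)), p.1) with hf
  set T' := T.filter fun c => BondIn (loK L j c.1) (bondHiK L j c.1 c.2) y μ with hT'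
  have hsub : T' ⊆ (Finset.univ : Finset (Fin d × Bool)).image f := by
    intro c hc
    rw [hT', mem_filter] at hc
    obtain ⟨t, ht⟩ := bondIn_box_cases hL j hc.2
    refine mem_image.2 ⟨(c.2, t), mem_univ _, ?_⟩
    rw [hf]
    ext1
    · exact ht.symm
    · rfl
  have hcard : (T'.card : ℝ) ≤ 2 * d := by
    have h1 : T'.card ≤ ((Finset.univ : Finset (Fin d × Bool)).image f).card := card_le_card hsub
    have h2 : ((Finset.univ : Finset (Fin d × Bool)).image f).card ≤ (Finset.univ : Finset (Fin d × Bool)).card :=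
      card_image_le
    rw [Finset.card_univ, Fintype.card_prod, Fintype.card_fin, Fintype.card_bool] at h2
    have : (T'.card : ℝ) ≤ ((d * 2 : ℕ) : ℝ) := by exact_mod_cast h1.trans h2
    simpa [mul_comm] using this
  have hw : (0 : ℝ) ≤ (((L : ℝ) ^ j) ^ d)⁻¹ := by positivity
  calc ∑ c ∈ T, kerQdd L j c.1 c.2 y μ
      = ∑ c ∈ T, (if BondIn (loK L j c.1) (bondHiK L j c.1 c.2) y μ then (((L : ℝ) ^ j) ^ d)⁻¹ else 0) :=
        sum_congr rfl fun c _ => by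
          by_cases h : BondIn (loK L j c.1) (bondHiK L j c.1 c.2) y μ
          · rw [kerQdd_of_bondIn h, if_pos h]
          · rw [kerQdd_of_not_bondIn h, if_neg h]
    _ = (T'.card : ℝ) * (((L : ℝ) ^ j) ^ d)⁻¹ := by rw [← sum_filter, sum_const, nsmul_eq_mul]
    _ ≤ 2 * d * (((L : ℝ) ^ j) ^ d)⁻¹ := mul_le_mul_of_nonneg_right hcard hw

end Count

/-! ## §3 The level-`j` piece with the concrete `C_j⁽²⁾(U₀, ·)` of [5] -/

section Concrete

variable {𝔸 : Type*} [NormedRing 𝔸] [NormedAlgebra ℂ 𝔸] [CompleteSpace 𝔸] [NormOneClass 𝔸]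

variable (L : ℕ) (hL : 2 ≤ L) {G : Subgroup 𝔸ˣ} (hG : AvgClosed d L G) (k : ℕ)
  (U₀ : Site d → Fin d → 𝔸ˣ) (hU₀ : ∀ x κ, U₀ x κ ∈ G) {α₀ : ℝ} (hα : 0 < α₀)
  (hα3 : C0 d * α₀ ≤ 1 / 3) (hα4 : 4 * α₀ ≤ c2' d L) (h52 : pdev U₀ < α₀ * (((L : ℝ) ^ k)⁻¹) ^ 2)
  {b : ℝ} (hb : 0 < b)
  (hsmall : Real.exp (4 * (800 * ((d : ℝ) + 1) ^ 2 * ((d : ℝ) + 4)) * α₀)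
    * (1 + 8 * (131072 * ((d : ℝ) + 1) ^ 2) * ((L : ℝ) ^ k * b)) ≤ 2)
  (hc₃ : 4 * ((L : ℝ) ^ k * b) < c3 d L)
  (h145 : 8 * d * thetaGen d L α₀ * (L : ℝ)⁻¹ ^ 4 ≤ 1)
  (h155 : (2 * (L : ℝ) - 1) * (L : ℝ)⁻¹ ^ 2 + 2 * d * thetaGen d L α₀ * (L : ℝ)⁻¹ ^ 3
    + 1 / 8 * (1 + 2 * d * thetaGen d L α₀ * (L : ℝ)⁻¹ ^ 2 + 2 * d * C3Gen d L * ((L : ℝ) ^ k * b)) * (L : ℝ)⁻¹ ^ 2 ≤ 1)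
  (S : Finset (Site d × Fin d)) (T : Finset (Site d × Fin d)) (w : Site d × Fin d → ℝ) (K : Site d × Fin d → 𝔸)

/-- `C₃ ≥ 0`. [folklore] -/
private theorem C3Gen_nonneg' (d L : ℕ) : 0 ≤ C3Gen d L := by
  unfold C3Gen C1ppGen; positivity

include hL hG hU₀ hα hα3 hα4 h52 hb hsmall hc₃ in
/-- **(3.136) AT LEVEL `j`, WITH THE CONCRETE `C_j⁽²⁾`**: the level-`j` piece `F(a) = Σ_{c∈T} w_c·C_j⁽²⁾(U₀, ins_S a)(c)·K(c)` of
`⟨C⁽²⁾(A), H*J⟩` (before the trace) is differentiable on `𝔸^S` and `DF(a)δa = Σ_c w_c·(D[C_j⁽²⁾(U₀, ins_S ·)(c)](a)δa)·K(c)` — «Δ⁽²⁾A = ΣΣ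
(Lʲη)^{d+1} tr (δ/δA)C_j⁽²⁾(A,b)(H*J)(b)» read as the derivative of the quadratic form (3.134) (cf. `B9Delta2Def134.eq_3136_sum`).
[cite: Balaban1985BackgroundPropagators, (3.134) p.422, (3.136) p.422, (3.137) p.423] -/
theorem hasFDerivAt_secondForm {j : ℕ} (hj : j ≤ k) (a : S → 𝔸) :
    HasFDerivAt (fun a' : S → 𝔸 => ∑ c ∈ T, (w c : ℂ) • (CCovIter2 L U₀ (insCfg S a') j c.1 c.2 * K c))
      (∑ c ∈ T, (w c : ℂ) • ((fderiv ℂ (fun a' : S → 𝔸 => CCovIter2 L U₀ (insCfg S a') j c.1 c.2) a).smulRight (K c))) a := by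
  refine HasFDerivAt.fun_sum fun c _ => ?_
  have h := (hasFDerivAt_CCovIter2_ins L hL hG k U₀ hU₀ hα hα3 hα4 h52 hb hsmall hc₃ S hj c.1 c.2 a)
  have h' : HasFDerivAt (fun a' : S → 𝔸 => CCovIter2 L U₀ (insCfg S a') j c.1 c.2)
      (fderiv ℂ (fun a' : S → 𝔸 => CCovIter2 L U₀ (insCfg S a') j c.1 c.2) a) a := h.differentiableAt.hasFDerivAt
  exact (h'.mul_const' (K c)).const_smul (w c : ℂ)

include hL hG hU₀ hα hα3 hα4 h52 hb hsmall hc₃ h145 h155 in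
/-- **THE DISPLAY AT LEVEL `j`, CONCRETE**: for `w_c ≥ 0`,
`‖DF(a)δa‖ ≤ C₃·(Lʲ)²·‖a‖·Σ_{c∈T} w_c·‖K(c)‖·Σ_{s∈S} kerQdd(c, s)·‖δa_s‖` — «(Lʲη)^{d+1}·|(H*J)(b)|·C₃|A|_b(Q″_j|δA|)(b)» summed over
`b ∈ Λ_j`, with (149) for `C_j⁽²⁾` (`B7Eq136SecondOrder.ineq149_secondOrder`) as the only analytic input.
[cite: Balaban1985BackgroundPropagators, (3.136) p.422, (3.137) p.423] [cite: Balaban1985Averaging, (149) p.40] -/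
theorem norm_fderiv_secondForm_le (hw : ∀ c ∈ T, 0 ≤ w c) {j : ℕ} (hj : j ≤ k) (a δa : S → 𝔸) :
    ‖fderiv ℂ (fun a' : S → 𝔸 => ∑ c ∈ T, (w c : ℂ) • (CCovIter2 L U₀ (insCfg S a') j c.1 c.2 * K c)) a δa‖ ≤
      C3Gen d L * ((L : ℝ) ^ j) ^ 2 * ‖a‖ *
        ∑ c ∈ T, w c * ‖K c‖ * ∑ s : S, kerQdd L j c.1 c.2 s.1.1 s.1.2 * ‖δa s‖ := by
  rw [(hasFDerivAt_secondForm L hL hG k U₀ hU₀ hα hα3 hα4 h52 hb hsmall hc₃ S T w K hj a).fderiv, mul_sum, _root_.sum_apply]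
  refine (norm_sum_le_of_le _ fun c hc => ?_)
  rw [smul_apply, ContinuousLinearMap.smulRight_apply, norm_smul, Complex.norm_real, Real.norm_of_nonneg (hw c hc)]
  obtain ⟨-, hbd⟩ := ineq149_secondOrder L hL hG k U₀ hU₀ hα hα3 hα4 h52 hb hsmall hc₃ h145 h155 S hj c.1 c.2 a δa
  have hQ0 : 0 ≤ ∑ s : S, kerQdd L j c.1 c.2 s.1.1 s.1.2 * ‖δa s‖ :=
    sum_nonneg fun s _ => mul_nonneg (kerQdd_nonneg L j _ _ _ _) (norm_nonneg _)
  calc w c * ‖fderiv ℂ (fun a' : S → 𝔸 => CCovIter2 L U₀ (insCfg S a') j c.1 c.2) a δa • K c‖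
      ≤ w c * (‖fderiv ℂ (fun a' : S → 𝔸 => CCovIter2 L U₀ (insCfg S a') j c.1 c.2) a δa‖ * ‖K c‖) :=
        mul_le_mul_of_nonneg_left (norm_smul_le _ _) (hw c hc)
    _ ≤ w c * ((C3Gen d L * ((L : ℝ) ^ j) ^ 2 * ‖a‖ * ∑ s : S, kerQdd L j c.1 c.2 s.1.1 s.1.2 * ‖δa s‖) * ‖K c‖) :=
        mul_le_mul_of_nonneg_left (mul_le_mul_of_nonneg_right hbd (norm_nonneg _)) (hw c hc)
    _ = C3Gen d L * ((L : ℝ) ^ j) ^ 2 * ‖a‖ * (w c * ‖K c‖ * ∑ s : S, kerQdd L j c.1 c.2 s.1.1 s.1.2 * ‖δa s‖) := by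
        ring

include hL hG hU₀ hα hα3 hα4 h52 hb hsmall hc₃ h145 h155 in
/-- **THE HENCE-STEP TO (3.137) AT LEVEL `j`, CONCRETE**: if `w_c·‖K(c)‖ ≤ κ₀` on `T` (`κ₀ ≥ 0`) («(Lʲη)^{d+1}·O(1)Mα₀(Lʲη)⁻³»), then for a variation
`X·e_s` supported on ONE fine bond `s ∈ S`, `‖DF(a)(X·e_s)‖ ≤ 2d·κ₀·C₃·(Lʲ)²·L^{−jd}·‖a‖·‖X‖` — the at most `2d` coarse bonds seeing `s`
(`sum_kerQdd_transpose_le`) each contribute `κ₀C₃(Lʲ)²‖a‖·L^{−jd}‖X‖`: «|(Δ⁽²⁾A)(b)| ≦ O(1)Mα₀(Lʲη)⁻²|A|» in tree units with `O(1) ↦ 2dC₃·O(1)`.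
[cite: Balaban1985BackgroundPropagators, (3.137) p.423] [cite: Balaban1985Averaging, (141)–(142) p.39, (149) p.40] -/
theorem norm_fderiv_secondForm_single_le (hw : ∀ c ∈ T, 0 ≤ w c) {κ₀ : ℝ} (hκ₀ : 0 ≤ κ₀) (hK : ∀ c ∈ T, w c * ‖K c‖ ≤ κ₀) {j : ℕ}
    (hj : j ≤ k) (a : S → 𝔸) (s : S) (X : 𝔸) :
    ‖fderiv ℂ (fun a' : S → 𝔸 => ∑ c ∈ T, (w c : ℂ) • (CCovIter2 L U₀ (insCfg S a') j c.1 c.2 * K c)) a (Pi.single s X)‖ ≤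
      2 * d * κ₀ * (C3Gen d L * ((L : ℝ) ^ j) ^ 2 * (((L : ℝ) ^ j) ^ d)⁻¹) * ‖a‖ * ‖X‖ := by
  classical
  have hL1 : 1 ≤ L := le_trans (by norm_num) hL
  have hC := C3Gen_nonneg' d L
  have h := norm_fderiv_secondForm_le L hL hG k U₀ hU₀ hα hα3 hα4 h52 hb hsmall hc₃ h145 h155 S T w K hw hj a (Pi.single s X)
  -- the inner sum over `S` sees only the bond `s`
  have hinner : ∀ c ∈ T, ∑ s' : S, kerQdd L j c.1 c.2 s'.1.1 s'.1.2 * ‖(Pi.single s X : S → 𝔸) s'‖ =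
      kerQdd L j c.1 c.2 s.1.1 s.1.2 * ‖X‖ := by
    intro c _
    rw [Finset.sum_eq_single s]
    · simp
    · intro s' _ hs'
      simp [Pi.single_eq_of_ne hs']
    · intro hs; exact absurd (mem_univ s) hs
  rw [sum_congr rfl fun c hc => by rw [hinner c hc]] at h
  refine h.trans ?_
  -- bound `w_c‖K_c‖` by `κ₀` and use the transpose count
  have hstep : ∑ c ∈ T, w c * ‖K c‖ * (kerQdd L j c.1 c.2 s.1.1 s.1.2 * ‖X‖) ≤
      κ₀ * ((2 * d * (((L : ℝ) ^ j) ^ d)⁻¹) * ‖X‖) := by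
    calc ∑ c ∈ T, w c * ‖K c‖ * (kerQdd L j c.1 c.2 s.1.1 s.1.2 * ‖X‖)
        ≤ ∑ c ∈ T, κ₀ * (kerQdd L j c.1 c.2 s.1.1 s.1.2 * ‖X‖) :=
          sum_le_sum fun c hc => mul_le_mul_of_nonneg_right (hK c hc)
            (mul_nonneg (kerQdd_nonneg L j _ _ _ _) (norm_nonneg _))
      _ = κ₀ * ((∑ c ∈ T, kerQdd L j c.1 c.2 s.1.1 s.1.2) * ‖X‖) := by rw [← mul_sum, sum_mul]
      _ ≤ κ₀ * ((2 * d * (((L : ℝ) ^ j) ^ d)⁻¹) * ‖X‖) :=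
          mul_le_mul_of_nonneg_left (mul_le_mul_of_nonneg_right (sum_kerQdd_transpose_le hL1 j T s.1.1 s.1.2) (norm_nonneg _)) hκ₀
  have hK0 : 0 ≤ C3Gen d L * ((L : ℝ) ^ j) ^ 2 * ‖a‖ := by positivity
  calc C3Gen d L * ((L : ℝ) ^ j) ^ 2 * ‖a‖ * ∑ c ∈ T, w c * ‖K c‖ * (kerQdd L j c.1 c.2 s.1.1 s.1.2 * ‖X‖)
      ≤ C3Gen d L * ((L : ℝ) ^ j) ^ 2 * ‖a‖ * (κ₀ * ((2 * d * (((L : ℝ) ^ j) ^ d)⁻¹) * ‖X‖)) :=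
        mul_le_mul_of_nonneg_left hstep hK0
    _ = 2 * d * κ₀ * (C3Gen d L * ((L : ℝ) ^ j) ^ 2 * (((L : ℝ) ^ j) ^ d)⁻¹) * ‖a‖ * ‖X‖ := by ring

end Concrete

end Literature.MathematicalPhysics.QuantumFieldTheory.Balaban1983to89.B9Ineq3137From149

end
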